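import Summits.Langlands.Langlands.Theses.MirrorPairReflection
import HarnessLib

/-!
# `MirrorPairReflection.CruxesToClassification` (stmt-Langlands-14483) — the body of `closes`, proved

[proof of `Summit.Langlands.Langlands.Theses.MirrorPairReflection.CruxesToClassification`
(route `MirrorPairReflection`, support item, rank 9): `KummerHerbrandSplitting → MirrorCriterion →
NonSelfMirrorReducible → SelfMirrorDihedral → ScalarResidueReducible →
EvenReducibleResidueClassification`]

Pure logic and integer arithmetic — the route's deciding theorem `closes` with the sector junction
`SectorComplement : EvenReducibleResidueClassification → Langlands` removed, so that an ITEM of the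
route concludes the classification target BY NAME.  For `p` odd and `σ : Γ_ℚ → GL₂(ℚ̄_p)` unramified
outside `p` with residual type `(a, b)`, `a + b` even: (1) scalar residue `a ≡ b (mod p−1)` is
reducible (`ScalarResidueReducible`), contradiction with irreducibility; (2) otherwise the mirror
criterion (`MirrorCriterion` fed by `KummerHerbrandSplitting`) gives `p ∣ B_m` and `p ∣ B_{p−1−m}`,
`m = (b − a) mod (p − 1)`; a genuine (non-self) mirror pair is reducible (`NonSelfMirrorReducible`);
(3) in the self-mirror case the arithmetic `2m = p − 1` (so `p ≡ 1 (mod 4)`, `m = (p−1)/2`) is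
derived by `omega`/`linarith` and `SelfMirrorDihedral` finishes.  No Literature named fact is
consumed; axioms `propext`, `Classical.choice`, `Quot.sound`. -/

set_option linter.dupNamespace false

namespace Summit.Langlands.Langlands.Theorems.MirrorPairReflectionCruxesToClassification

open Summit.Langlands.Langlands.Theses.MirrorPairReflection

/-- **stmt-Langlands-14483** `MirrorPairReflection.CruxesToClassification`: the five cruxes/supports
imply `EvenReducibleResidueClassification` (the body of `closes` without the sector junction). -/
theorem cruxesToClassification : CruxesToClassification := by
  intro hK hM hN hS hR p _ hp σ a b hU hE hT hI
  have hp3 : 3 ≤ p := by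
    have h2 := (Fact.out : p.Prime).two_le
    omega
  -- case 1: scalar residue (a ≡ b mod p-1) is reducible
  by_cases h1 : ((p : ℤ) - 1 ∣ (b : ℤ) - a)
  · exact absurd hI (hR p hp σ a b hU h1 hT)
  -- otherwise the mirror criterion gives p ∣ B_m and p ∣ B_{p-1-m}
  obtain ⟨d1, d2⟩ := hM hK p hp σ a b hU hE h1 hT hI
  -- case 2: a genuine (non-self) mirror pair is reducible
  by_cases h2 : ((p : ℤ) - 1 ∣ 2 * ((b : ℤ) - a))
  swap
  · exact absurd hI (hN p hp σ a b hU hE h2 hT d1 d2)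
  -- case 3: self-mirror index; arithmetic: m = (p-1)/2 and p ≡ 1 (mod 4)
  set q : ℤ := (p : ℤ) - 1 with hq
  set m : ℤ := ((b : ℤ) - a) % q with hm
  set X : ℤ := ((b : ℤ) - a) / q with hX
  have hq0 : 0 < q := by omega
  have hm0 : 0 ≤ m := Int.emod_nonneg _ (by omega)
  have hmq : m < q := Int.emod_lt_of_pos _ hq0
  have hfm : m + q * X = (b : ℤ) - a := Int.emod_add_mul_ediv _ _
  have hm_ne : m ≠ 0 := fun h0 => h1 (Int.dvd_of_emod_eq_zero h0)
  obtain ⟨e, he⟩ := h2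
  have h2m : 2 * m = q * (e - 2 * X) := by
    rw [mul_sub, ← he]
    linarith
  have hc : e - 2 * X = 1 := by
    set c := e - 2 * X with hcdef
    have hmpos : 0 < m := lt_of_le_of_ne hm0 (Ne.symm hm_ne)
    rcases le_or_gt c 0 with hc0 | hc0
    · have : q * c ≤ 0 := mul_nonpos_iff.mpr (Or.inl ⟨hq0.le, hc0⟩)
      linarith
    · rcases le_or_gt c 1 with hc1 | hc1
      · omega
      · have : q * 2 ≤ q * c := mul_le_mul_of_nonneg_left (by omega) hq0.le
        linarith
  have h2mq : 2 * m = q := by rw [h2m, hc, mul_one]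
  obtain ⟨k, hk⟩ := (Nat.Prime.eq_two_or_odd' (Fact.out : p.Prime)).resolve_left hp
  obtain ⟨r, hr⟩ := hE
  have hkZ : (p : ℤ) = 2 * k + 1 := by exact_mod_cast hk
  have hrZ : (a : ℤ) + b = r + r := by exact_mod_cast hr
  obtain ⟨t, ht⟩ : ∃ t : ℤ, (k : ℤ) * X = t := ⟨_, rfl⟩
  have hqk : q = 2 * k := by omega
  have hqX : q * X = 2 * t := by rw [hqk, mul_assoc, ht]
  have hbat : (b : ℤ) - a = 2 * t + m := by linarith
  have hidx : (((b : ℤ) - a) % ((p : ℤ) - 1)).toNat = (p - 1) / 2 := by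
    show m.toNat = (p - 1) / 2
    omega
  have hB : (p : ℤ) ∣ (bernoulli ((p - 1) / 2)).num := by
    rw [← hidx]; exact d1
  refine ⟨by omega, ?_, hB, ?_⟩
  · show 2 * m.toNat = p - 1
    omega
  · exact hS p hp σ a b hU ⟨r, hr⟩ h1 ⟨e, he⟩ hT hB hI

end Summit.Langlands.Langlands.Theorems.MirrorPairReflectionCruxesToClassification
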